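import Mathlib.GroupTheory.Perm.Cycle.Factors
import Mathlib.Combinatorics.Hall.Basic
import Mathlib.Algebra.Order.BigOperators.Group.Finset
import Mathlib.Tactic.Linarith
import Mathlib.Tactic.Ring

/-!
# Route «KPlusLogSqLaw», crux `TropicalB` (stmt-ValiantsHypothesis-19771) — MARKED-EDGE sector, FOUR-BIT LAW, part 3:
# EXCHANGE LEMMAS — a unique maximiser at two / three parameter values forces ONE relative cycle / NO third cover

HONEST FRAMING.  Helper file (cell `pub-symmetroid`, seat val-sym-trop-p4 (g16), 2026-08-28; `--supports stmt-ValiantsHypothesis-19771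
--as helper`).  Third file of the kernel version of the lineage's «MARKED-EDGE FOUR-BIT LAW» (g15 THEOREM-FOURBIT.md Lemmas 1–3; here
WITHOUT the tie-freeness step of its Lemma 0 and WITHOUT Karamata — an Abel summation suffices).  Nothing here concerns `TropicalB` in
its window, `WeakLifting`, the doors, `MatrixDescartes` (stmt-ValiantsHypothesis-18050) or VP ≠ VNP.
ABSTRACT COVER SETTING (inline, no definition).  `V` finite; a COVER is `σ : Equiv.Perm V` (arcs `i → σ i`); arcs carry a presence
predicate `ok`, integer weights `w` and integer slopes `g`; SCORE at the parameter `θ` = `∑ i, (w i (σ i) + θ * g i (σ i))`, SLOPE =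
`∑ i, g i (σ i)`; «UNIQUE MAXIMISER at `θ`» = present and every other present cover scores strictly less (the tree's `IsDominant` read
through a static design; part 4 does the reading).  CONTENTS: `abel_two` / `abel_three` (arithmetic core); `isCycle_of_pair` — **PAIR
EXCHANGE**: unique maximisers `σ₁ ≠ σ₂` at `θ₁ < θ₂` with no cover built from their arcs of slope strictly between theirs ⇒
`σ₁⁻¹ * σ₂` is ONE cycle (explicit split along `Equiv.Perm.cycleOf`); `two_factor` — every cover inside the arcs of `σ₁, σ₂, σ₃`
extends to a factorisation of `σ₁ ⊎ σ₂ ⊎ σ₃` (Hall's theorem on the 2-regular remainder; factorisations are recorded pointwise as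
`List.Perm [R i, M₂ i, M₃ i] [σ₁ i, σ₂ i, σ₃ i]`); `no_third_cover` — **TRIPLE EXCHANGE**: unique maximisers at `θ₁ < θ₂ < θ₃` whose
factorisations always have a factor of slope `≤ slope σ₁` and ANOTHER of slope `≥ slope σ₃` admit no fourth cover inside their arcs.
-/

set_option linter.dupNamespace false
set_option autoImplicit false

namespace Summit.ValiantsHypothesis.ValiantsHypothesis.Theorems.KPlusLogSqLaw
namespace MarkedEdge
namespace FourBit

open Finset

/-! ### Arithmetic core (Abel summation) -/

/-- Two factors: if `B₁ + θ₁ y₁ ≤ A₁ + θ₁ x₁`, `B₂ + θ₂ y₂ ≤ A₂ + θ₂ x₂` with `θ₁ < θ₂`, `B₁ + B₂ = A₁ + A₂`, `y₁ + y₂ = x₁ + x₂`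
and `x₂ ≤ y₂`, then both inequalities are equalities. [folklore: Abel summation] -/
theorem abel_two {θ₁ θ₂ A₁ A₂ B₁ B₂ x₁ x₂ y₁ y₂ : ℤ} (hθ : θ₁ < θ₂) (hW : B₁ + B₂ = A₁ + A₂) (hG : y₁ + y₂ = x₁ + x₂)
    (hs : x₂ ≤ y₂) (h₁ : B₁ + θ₁ * y₁ ≤ A₁ + θ₁ * x₁) (h₂ : B₂ + θ₂ * y₂ ≤ A₂ + θ₂ * x₂) :
    B₁ + θ₁ * y₁ = A₁ + θ₁ * x₁ ∧ B₂ + θ₂ * y₂ = A₂ + θ₂ * x₂ := by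
  have key : 0 ≤ (θ₂ - θ₁) * (y₂ - x₂) := mul_nonneg (by linarith) (by linarith)
  have ek : (θ₂ - θ₁) * (y₂ - x₂) = θ₂ * y₂ - θ₂ * x₂ - θ₁ * y₂ + θ₁ * x₂ := by ring
  have hy : y₁ = x₁ + x₂ - y₂ := by linarith
  have e₁ : θ₁ * y₁ = θ₁ * x₁ + θ₁ * x₂ - θ₁ * y₂ := by rw [hy]; ring
  exact ⟨le_antisymm h₁ (by linarith), le_antisymm h₂ (by linarith)⟩

/-- Three factors: the same with `θ₁ < θ₂ < θ₃`, equal totals, and the domination `x₃ ≤ y₃`, `x₂ + x₃ ≤ y₂ + y₃`.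
[folklore: Abel summation] -/
theorem abel_three {θ₁ θ₂ θ₃ A₁ A₂ A₃ B₁ B₂ B₃ x₁ x₂ x₃ y₁ y₂ y₃ : ℤ} (h12 : θ₁ < θ₂) (h23 : θ₂ < θ₃)
    (hW : B₁ + B₂ + B₃ = A₁ + A₂ + A₃) (hG : y₁ + y₂ + y₃ = x₁ + x₂ + x₃) (hs₃ : x₃ ≤ y₃) (hs₂₃ : x₂ + x₃ ≤ y₂ + y₃)
    (h₁ : B₁ + θ₁ * y₁ ≤ A₁ + θ₁ * x₁) (h₂ : B₂ + θ₂ * y₂ ≤ A₂ + θ₂ * x₂) (h₃ : B₃ + θ₃ * y₃ ≤ A₃ + θ₃ * x₃) :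
    B₁ + θ₁ * y₁ = A₁ + θ₁ * x₁ ∧ B₂ + θ₂ * y₂ = A₂ + θ₂ * x₂ ∧ B₃ + θ₃ * y₃ = A₃ + θ₃ * x₃ := by
  have key₁ : 0 ≤ (θ₂ - θ₁) * (y₂ + y₃ - x₂ - x₃) := mul_nonneg (by linarith) (by linarith)
  have key₂ : 0 ≤ (θ₃ - θ₂) * (y₃ - x₃) := mul_nonneg (by linarith) (by linarith)
  have ek₁ : (θ₂ - θ₁) * (y₂ + y₃ - x₂ - x₃)
      = θ₂ * y₂ + θ₂ * y₃ - θ₂ * x₂ - θ₂ * x₃ - θ₁ * y₂ - θ₁ * y₃ + θ₁ * x₂ + θ₁ * x₃ := by ring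
  have ek₂ : (θ₃ - θ₂) * (y₃ - x₃) = θ₃ * y₃ - θ₃ * x₃ - θ₂ * y₃ + θ₂ * x₃ := by ring
  have hy : y₁ = x₁ + x₂ + x₃ - y₂ - y₃ := by linarith
  have e₁ : θ₁ * y₁ = θ₁ * x₁ + θ₁ * x₂ + θ₁ * x₃ - θ₁ * y₂ - θ₁ * y₃ := by rw [hy]; ring
  exact ⟨le_antisymm h₁ (by linarith), le_antisymm h₂ (by linarith), le_antisymm h₃ (by linarith)⟩

variable {V : Type*} [Fintype V] [DecidableEq V]

omit [DecidableEq V] in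
/-- The score splits as weight plus `θ` times slope. [folklore] -/
theorem score_eq (w g : V → V → ℤ) (θ : ℤ) (τ : Equiv.Perm V) :
    ∑ i, (w i (τ i) + θ * g i (τ i)) = (∑ i, w i (τ i)) + θ * ∑ i, g i (τ i) := by
  rw [Finset.sum_add_distrib, Finset.mul_sum]

/-- From unique maximality: every present cover scores at most the maximiser's score (weight/slope form). [folklore] -/
theorem score_le_of_isMax (ok : V → V → Prop) (w g : V → V → ℤ) {θ : ℤ} {σ τ : Equiv.Perm V}
    (hσ : (∀ i, ok i (σ i)) ∧ ∀ τ : Equiv.Perm V, τ ≠ σ → (∀ i, ok i (τ i)) →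
      ∑ i, (w i (τ i) + θ * g i (τ i)) < ∑ i, (w i (σ i) + θ * g i (σ i)))
    (hτ : ∀ i, ok i (τ i)) :
    (∑ i, w i (τ i)) + θ * ∑ i, g i (τ i) ≤ (∑ i, w i (σ i)) + θ * ∑ i, g i (σ i) := by
  by_cases h : τ = σ
  · rw [h]
  · have := hσ.2 τ h hτ
    rw [score_eq, score_eq] at this
    exact this.le

omit [DecidableEq V] in
/-- … and strictly less if it is a different cover. [folklore] -/
theorem score_lt_of_isMax (ok : V → V → Prop) (w g : V → V → ℤ) {θ : ℤ} {σ τ : Equiv.Perm V}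
    (hσ : (∀ i, ok i (σ i)) ∧ ∀ τ : Equiv.Perm V, τ ≠ σ → (∀ i, ok i (τ i)) →
      ∑ i, (w i (τ i) + θ * g i (τ i)) < ∑ i, (w i (σ i) + θ * g i (σ i)))
    (hτ : ∀ i, ok i (τ i)) (hne : τ ≠ σ) :
    (∑ i, w i (τ i)) + θ * ∑ i, g i (τ i) < (∑ i, w i (σ i)) + θ * ∑ i, g i (σ i) := by
  have := hσ.2 τ hne hτ
  rwa [score_eq, score_eq] at this

/-! ### Pair exchange: the relative permutation of two consecutive maximisers is one cycle -/

/-- **PAIR EXCHANGE LEMMA.**  Let `σ₁ ≠ σ₂` be the unique maximisers (among present covers) of the score at `θ₁ < θ₂`, and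
assume the SLOPE GAP: every cover `F` whose arcs are arcs of `σ₁` or `σ₂` (`F i ∈ {σ₁ i, σ₂ i}` for all `i`) has slope `≤` that of
`σ₁` or `≥` that of `σ₂`.  Then `σ₁⁻¹ * σ₂` is a cycle: the arcs where `σ₂` differs from `σ₁` form ONE alternating cycle.
Proof: split `π = σ₁⁻¹ σ₂` along the cycle `ρ` of a moved point (`Equiv.Perm.cycleOf`); `F₁ = σ₁ ρ`, `F₂ = σ₂ ρ⁻¹` factorise
`σ₁ ⊎ σ₂`; the maximiser inequalities at `θ₁, θ₂` and Abel summation (`abel_two`) force `{F₁, F₂} = {σ₁, σ₂}`, whence `ρ = π`.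
[this seat's lemma; THEOREM-FOURBIT.md Lemma 2 (pairs), tie-freeness not needed] -/
theorem isCycle_of_pair (ok : V → V → Prop) (w g : V → V → ℤ) {θ₁ θ₂ : ℤ} (hθ : θ₁ < θ₂)
    {σ₁ σ₂ : Equiv.Perm V} (hne : σ₁ ≠ σ₂)
    (h₁ : (∀ i, ok i (σ₁ i)) ∧ ∀ τ : Equiv.Perm V, τ ≠ σ₁ → (∀ i, ok i (τ i)) →
      ∑ i, (w i (τ i) + θ₁ * g i (τ i)) < ∑ i, (w i (σ₁ i) + θ₁ * g i (σ₁ i)))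
    (h₂ : (∀ i, ok i (σ₂ i)) ∧ ∀ τ : Equiv.Perm V, τ ≠ σ₂ → (∀ i, ok i (τ i)) →
      ∑ i, (w i (τ i) + θ₂ * g i (τ i)) < ∑ i, (w i (σ₂ i) + θ₂ * g i (σ₂ i)))
    (hgap : ∀ F : Equiv.Perm V, (∀ i, F i = σ₁ i ∨ F i = σ₂ i) →
      (∑ i, g i (F i)) ≤ (∑ i, g i (σ₁ i)) ∨ (∑ i, g i (σ₂ i)) ≤ ∑ i, g i (F i)) :
    (σ₁⁻¹ * σ₂).IsCycle := by
  set π : Equiv.Perm V := σ₁⁻¹ * σ₂ with hπ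
  have hπ1 : π ≠ 1 := fun h => hne (inv_mul_eq_one.mp h)
  obtain ⟨a, ha⟩ : ∃ a, π a ≠ a := by
    by_contra h; push Not at h; exact hπ1 (Equiv.ext h)
  set ρ : Equiv.Perm V := π.cycleOf a with hρ
  have hρs : ∀ i, π.SameCycle a i → ρ i = π i := fun i h => h.cycleOf_apply
  have hρn : ∀ i, ¬ π.SameCycle a i → ρ i = i := fun i h => Equiv.Perm.cycleOf_apply_of_not_sameCycle h
  have hρs' : ∀ i, π.SameCycle a i → ρ⁻¹ i = π⁻¹ i := fun i h => by
    rw [hρ, Equiv.Perm.cycleOf_inv]; exact (Equiv.Perm.sameCycle_inv.mpr h).cycleOf_apply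
  have hρn' : ∀ i, ¬ π.SameCycle a i → ρ⁻¹ i = i := fun i h => by
    rw [hρ, Equiv.Perm.cycleOf_inv]; exact Equiv.Perm.cycleOf_apply_of_not_sameCycle (by rwa [Equiv.Perm.sameCycle_inv])
  have hπi : ∀ i, σ₁ (π i) = σ₂ i := fun i => by simp [hπ]
  have hπi' : ∀ i, σ₂ (π⁻¹ i) = σ₁ i := fun i => by simp [hπ]
  -- the two factors
  set F₁ : Equiv.Perm V := σ₁ * ρ with hF₁
  set F₂ : Equiv.Perm V := σ₂ * ρ⁻¹ with hF₂
  have hdec : ∀ i, (F₁ i = σ₁ i ∧ F₂ i = σ₂ i) ∨ (F₁ i = σ₂ i ∧ F₂ i = σ₁ i) := by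
    intro i
    by_cases h : π.SameCycle a i
    · right
      exact ⟨by rw [hF₁, Equiv.Perm.mul_apply, hρs i h, hπi], by rw [hF₂, Equiv.Perm.mul_apply, hρs' i h, hπi']⟩
    · left
      exact ⟨by rw [hF₁, Equiv.Perm.mul_apply, hρn i h], by rw [hF₂, Equiv.Perm.mul_apply, hρn' i h]⟩
  have hok₁ : ∀ i, ok i (F₁ i) := fun i => by
    rcases hdec i with ⟨h, -⟩ | ⟨h, -⟩ <;> rw [h]
    exacts [h₁.1 i, h₂.1 i]
  have hok₂ : ∀ i, ok i (F₂ i) := fun i => by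
    rcases hdec i with ⟨-, h⟩ | ⟨-, h⟩ <;> rw [h]
    exacts [h₂.1 i, h₁.1 i]
  have harc : ∀ i, F₁ i = σ₁ i ∨ F₁ i = σ₂ i := fun i => by
    rcases hdec i with ⟨h, -⟩ | ⟨h, -⟩
    exacts [Or.inl h, Or.inr h]
  have hW : (∑ i, w i (F₁ i)) + ∑ i, w i (F₂ i) = (∑ i, w i (σ₁ i)) + ∑ i, w i (σ₂ i) := by
    rw [← Finset.sum_add_distrib, ← Finset.sum_add_distrib]
    exact Finset.sum_congr rfl fun i _ => by
      rcases hdec i with ⟨ha, hb⟩ | ⟨ha, hb⟩ <;> rw [ha, hb]; ring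
  have hG : (∑ i, g i (F₁ i)) + ∑ i, g i (F₂ i) = (∑ i, g i (σ₁ i)) + ∑ i, g i (σ₂ i) := by
    rw [← Finset.sum_add_distrib, ← Finset.sum_add_distrib]
    exact Finset.sum_congr rfl fun i _ => by
      rcases hdec i with ⟨ha, hb⟩ | ⟨ha, hb⟩ <;> rw [ha, hb]; ring
  have hρa : ρ a = π a := hρs a (Equiv.Perm.SameCycle.refl π a)
  rcases hgap F₁ harc with hlo | hhi
  · -- `F₁` low, `F₂` high: Abel forces `F₁ = σ₁`, i.e. `ρ = 1` — impossible
    exfalso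
    have hs : (∑ i, g i (σ₂ i)) ≤ ∑ i, g i (F₂ i) := by linarith
    obtain ⟨e₁, -⟩ := abel_two hθ hW hG hs (score_le_of_isMax ok w g h₁ hok₁) (score_le_of_isMax ok w g h₂ hok₂)
    have hF : F₁ = σ₁ := by
      by_contra hne₁
      exact absurd e₁ (ne_of_lt (score_lt_of_isMax ok w g h₁ hok₁ hne₁))
    have : ρ = 1 := by
      have := congrArg (fun τ => σ₁⁻¹ * τ) hF
      simpa [hF₁] using this
    apply ha
    rw [← hρa, this, Equiv.Perm.one_apply]
  · -- `F₁` high: Abel with the factors in the other order forces `F₁ = σ₂`, i.e. `ρ = π`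
    have hW' : (∑ i, w i (F₂ i)) + ∑ i, w i (F₁ i) = (∑ i, w i (σ₁ i)) + ∑ i, w i (σ₂ i) := by linarith
    have hG' : (∑ i, g i (F₂ i)) + ∑ i, g i (F₁ i) = (∑ i, g i (σ₁ i)) + ∑ i, g i (σ₂ i) := by linarith
    obtain ⟨-, e₂⟩ := abel_two hθ hW' hG' hhi (score_le_of_isMax ok w g h₁ hok₂) (score_le_of_isMax ok w g h₂ hok₁)
    have hF : F₁ = σ₂ := by
      by_contra hne₂
      exact absurd e₂ (ne_of_lt (score_lt_of_isMax ok w g h₂ hok₁ hne₂))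
    have hρπ : ρ = π := by
      have := congrArg (fun τ => σ₁⁻¹ * τ) hF
      simpa [hF₁, hπ] using this
    have hc : ρ.IsCycle := Equiv.Perm.isCycle_cycleOf π ha
    rwa [hρπ] at hc

/-! ### Factorisations of three covers and the triple exchange lemma -/

omit [DecidableEq V] in
/-- A factorisation preserves total weight (any arc function). [folklore] -/
theorem sum_eq_of_factorisation (f : V → V → ℤ) {σ₁ σ₂ σ₃ F₁ F₂ F₃ : Equiv.Perm V}
    (hP : ∀ i, List.Perm [F₁ i, F₂ i, F₃ i] [σ₁ i, σ₂ i, σ₃ i]) :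
    (∑ i, f i (F₁ i)) + (∑ i, f i (F₂ i)) + ∑ i, f i (F₃ i)
      = (∑ i, f i (σ₁ i)) + (∑ i, f i (σ₂ i)) + ∑ i, f i (σ₃ i) := by
  rw [← Finset.sum_add_distrib, ← Finset.sum_add_distrib, ← Finset.sum_add_distrib, ← Finset.sum_add_distrib]
  refine Finset.sum_congr rfl fun i _ => ?_
  have := ((hP i).map (f i)).sum_eq
  simp only [List.map_cons, List.map_nil, List.sum_cons, List.sum_nil, add_zero] at this
  linarith

omit [Fintype V] [DecidableEq V] in
/-- A factor of a factorisation of present covers is present. [folklore] -/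
theorem ok_of_factorisation (ok : V → V → Prop) {σ₁ σ₂ σ₃ F₁ F₂ F₃ : Equiv.Perm V}
    (hP : ∀ i, List.Perm [F₁ i, F₂ i, F₃ i] [σ₁ i, σ₂ i, σ₃ i])
    (h₁ : ∀ i, ok i (σ₁ i)) (h₂ : ∀ i, ok i (σ₂ i)) (h₃ : ∀ i, ok i (σ₃ i)) :
    (∀ i, ok i (F₁ i)) ∧ (∀ i, ok i (F₂ i)) ∧ (∀ i, ok i (F₃ i)) := by
  have mem : ∀ i x, x ∈ [F₁ i, F₂ i, F₃ i] → ok i x := by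
    intro i x hx
    have hx' := (hP i).mem_iff.mp hx
    simp only [List.mem_cons, List.not_mem_nil, or_false] at hx'
    rcases hx' with h | h | h <;> rw [h]
    exacts [h₁ i, h₂ i, h₃ i]
  exact ⟨fun i => mem i _ (by simp), fun i => mem i _ (by simp), fun i => mem i _ (by simp)⟩

/-- **Core of the triple exchange (fixed labelling).**  `σ₁, σ₂, σ₃` unique maximisers at `θ₁ < θ₂ < θ₃`; `(F₁, F₂, F₃)` a
factorisation of `σ₁ ⊎ σ₂ ⊎ σ₃` with slope of `F₁` at most that of `σ₁` and slope of `F₃` at least that of `σ₃`; then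
`F₁ = σ₁`, `F₂ = σ₂`, `F₃ = σ₃`. [this seat's lemma; THEOREM-FOURBIT.md Lemma 2 (triples)] -/
theorem factors_eq (ok : V → V → Prop) (w g : V → V → ℤ) {θ₁ θ₂ θ₃ : ℤ} (h12 : θ₁ < θ₂) (h23 : θ₂ < θ₃)
    {σ₁ σ₂ σ₃ : Equiv.Perm V}
    (h₁ : (∀ i, ok i (σ₁ i)) ∧ ∀ τ : Equiv.Perm V, τ ≠ σ₁ → (∀ i, ok i (τ i)) →
      ∑ i, (w i (τ i) + θ₁ * g i (τ i)) < ∑ i, (w i (σ₁ i) + θ₁ * g i (σ₁ i)))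
    (h₂ : (∀ i, ok i (σ₂ i)) ∧ ∀ τ : Equiv.Perm V, τ ≠ σ₂ → (∀ i, ok i (τ i)) →
      ∑ i, (w i (τ i) + θ₂ * g i (τ i)) < ∑ i, (w i (σ₂ i) + θ₂ * g i (σ₂ i)))
    (h₃ : (∀ i, ok i (σ₃ i)) ∧ ∀ τ : Equiv.Perm V, τ ≠ σ₃ → (∀ i, ok i (τ i)) →
      ∑ i, (w i (τ i) + θ₃ * g i (τ i)) < ∑ i, (w i (σ₃ i) + θ₃ * g i (σ₃ i)))
    {F₁ F₂ F₃ : Equiv.Perm V} (hP : ∀ i, List.Perm [F₁ i, F₂ i, F₃ i] [σ₁ i, σ₂ i, σ₃ i])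
    (hlo : (∑ i, g i (F₁ i)) ≤ ∑ i, g i (σ₁ i)) (hhi : (∑ i, g i (σ₃ i)) ≤ ∑ i, g i (F₃ i)) :
    F₁ = σ₁ ∧ F₂ = σ₂ ∧ F₃ = σ₃ := by
  obtain ⟨hok₁, hok₂, hok₃⟩ := ok_of_factorisation ok hP h₁.1 h₂.1 h₃.1
  have hW := sum_eq_of_factorisation w hP
  have hG := sum_eq_of_factorisation g hP
  have hs₂₃ : (∑ i, g i (σ₂ i)) + (∑ i, g i (σ₃ i)) ≤ (∑ i, g i (F₂ i)) + ∑ i, g i (F₃ i) := by linarith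
  obtain ⟨e₁, e₂, e₃⟩ := abel_three h12 h23 hW hG hhi hs₂₃ (score_le_of_isMax ok w g h₁ hok₁)
    (score_le_of_isMax ok w g h₂ hok₂) (score_le_of_isMax ok w g h₃ hok₃)
  refine ⟨?_, ?_, ?_⟩
  · by_contra hne; exact absurd e₁ (ne_of_lt (score_lt_of_isMax ok w g h₁ hok₁ hne))
  · by_contra hne; exact absurd e₂ (ne_of_lt (score_lt_of_isMax ok w g h₂ hok₂ hne))
  · by_contra hne; exact absurd e₃ (ne_of_lt (score_lt_of_isMax ok w g h₃ hok₃ hne))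

/-- Indicator sum of a permutation hitting a point: exactly one preimage. [folklore] -/
theorem sum_ite_apply_eq (σ : Equiv.Perm V) (j : V) : (∑ i, if σ i = j then (1 : ℕ) else 0) = 1 := by
  rw [Finset.sum_eq_single (σ.symm j)]
  · simp
  · intro i _ hi; rw [if_neg]; intro h; apply hi; rw [← h]; simp
  · simp

/-- **Two-factorisation of the remainder (Hall).**  Every cover `R` whose arcs are arcs of `σ₁`, `σ₂` or `σ₃` extends to a
factorisation `(R, M₂, M₃)` of the arc multiset `σ₁ ⊎ σ₂ ⊎ σ₃`: the remainder is a 2-regular bipartite multigraph, which has a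
perfect matching by Hall's theorem, and the rest is again a perfect matching. [folklore: König / Hall for regular bipartite
multigraphs; THEOREM-FOURBIT.md Lemma 1] -/
theorem two_factor (σ₁ σ₂ σ₃ R : Equiv.Perm V) (hR : ∀ i, R i = σ₁ i ∨ R i = σ₂ i ∨ R i = σ₃ i) :
    ∃ M₂ M₃ : Equiv.Perm V, ∀ i, List.Perm [R i, M₂ i, M₃ i] [σ₁ i, σ₂ i, σ₃ i] := by
  classical
  -- the remaining two targets at each node
  let a : V → V := fun i => if R i = σ₁ i then σ₂ i else σ₁ i
  let b : V → V := fun i => if R i = σ₁ i then σ₃ i else if R i = σ₂ i then σ₃ i else σ₂ i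
  have hPab : ∀ i, List.Perm [R i, a i, b i] [σ₁ i, σ₂ i, σ₃ i] := by
    intro i
    by_cases h1 : R i = σ₁ i
    · simp only [a, b, if_pos h1]; rw [h1]
    · by_cases h2 : R i = σ₂ i
      · simp only [a, b, if_neg h1, if_pos h2]; rw [h2]
        exact List.Perm.swap (σ₁ i) (σ₂ i) [σ₃ i]
      · have h3 : R i = σ₃ i := by rcases hR i with h | h | h; exacts [absurd h h1, absurd h h2, h]
        simp only [a, b, if_neg h1, if_neg h2]; rw [h3]
        exact (List.Perm.swap (σ₁ i) (σ₃ i) [σ₂ i]).trans (List.Perm.cons (σ₁ i) (List.Perm.swap (σ₂ i) (σ₃ i) []))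
  -- column count of the remainder: every node is the target of exactly two remaining arcs
  have hcol : ∀ j, (∑ i, if a i = j then (1 : ℕ) else 0) + (∑ i, if b i = j then (1 : ℕ) else 0) = 2 := by
    intro j
    have hpt : ∀ i, (if R i = j then (1 : ℕ) else 0) + (if a i = j then 1 else 0) + (if b i = j then 1 else 0)
        = (if σ₁ i = j then (1 : ℕ) else 0) + (if σ₂ i = j then 1 else 0) + (if σ₃ i = j then 1 else 0) := by
      intro i
      have := ((hPab i).map fun x => if x = j then (1 : ℕ) else 0).sum_eq
      simpa [add_assoc] using this
    have hsum := Finset.sum_congr rfl fun i (_ : i ∈ (Finset.univ : Finset V)) => hpt i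
    rw [Finset.sum_add_distrib, Finset.sum_add_distrib, Finset.sum_add_distrib, Finset.sum_add_distrib,
      sum_ite_apply_eq R j, sum_ite_apply_eq σ₁ j, sum_ite_apply_eq σ₂ j, sum_ite_apply_eq σ₃ j] at hsum
    omega
  -- Hall's condition for `t i = {a i, b i}`
  have hHall : ∀ s : Finset V, s.card ≤ (s.biUnion fun i => ({a i, b i} : Finset V)).card := by
    intro s
    let f : V × Bool → V := fun p => if p.2 then a p.1 else b p.1
    have Hf : ∀ p ∈ s ×ˢ (Finset.univ : Finset Bool), f p ∈ s.biUnion fun i => ({a i, b i} : Finset V) := by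
      rintro ⟨i, e⟩ hp
      rw [Finset.mem_product] at hp
      rw [Finset.mem_biUnion]
      refine ⟨i, hp.1, ?_⟩
      cases e <;> simp [f]
    have hfib : ∀ j ∈ s.biUnion (fun i => ({a i, b i} : Finset V)),
        ((s ×ˢ (Finset.univ : Finset Bool)).filter fun p => f p = j).card ≤ 2 := by
      intro j _
      calc ((s ×ˢ (Finset.univ : Finset Bool)).filter fun p => f p = j).card
          ≤ ((Finset.univ : Finset (V × Bool)).filter fun p => f p = j).card :=
            Finset.card_le_card (Finset.filter_subset_filter _ (Finset.subset_univ _))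
        _ = ∑ p : V × Bool, if f p = j then 1 else 0 := Finset.card_filter _ _
        _ = ∑ i : V, ((if a i = j then 1 else 0) + (if b i = j then 1 else 0)) := by
            rw [Fintype.sum_prod_type]
            refine Finset.sum_congr rfl fun i _ => ?_
            rw [Fintype.sum_bool]; simp [f]
        _ = 2 := by rw [Finset.sum_add_distrib]; exact hcol j
    have h := Finset.card_le_mul_card_image_of_maps_to Hf 2 hfib
    rw [Finset.card_product, Finset.card_univ, Fintype.card_bool] at h
    omega
  obtain ⟨f, hfinj, hfmem⟩ := (Finset.all_card_le_biUnion_card_iff_exists_injective _).mp hHall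
  have hf : ∀ i, f i = a i ∨ f i = b i := fun i => by simpa using hfmem i
  have hfbij : Function.Bijective f := Finite.injective_iff_bijective.mp hfinj
  -- the third factor
  let c : V → V := fun i => if f i = a i then b i else a i
  have hfc : ∀ i, (f i = a i ∧ c i = b i) ∨ (f i = b i ∧ c i = a i) := by
    intro i
    by_cases h : f i = a i
    · exact Or.inl ⟨h, by simp only [c, if_pos h]⟩
    · exact Or.inr ⟨(hf i).resolve_left h, by simp only [c, if_neg h]⟩
  -- indicator of node `j` among the remaining arcs at `i`
  have hind_f : ∀ i j, f i = j → 1 ≤ (if a i = j then (1 : ℕ) else 0) + (if b i = j then 1 else 0) := by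
    intro i j h
    rcases hf i with h' | h'
    · rw [if_pos (h'.symm.trans h)]; omega
    · rw [if_pos (h'.symm.trans h : b i = j)]; omega
  have hind_c : ∀ i j, c i = j → 1 ≤ (if a i = j then (1 : ℕ) else 0) + (if b i = j then 1 else 0) := by
    intro i j h
    rcases hfc i with ⟨-, h'⟩ | ⟨-, h'⟩
    · rw [if_pos (h'.symm.trans h : b i = j)]; omega
    · rw [if_pos (h'.symm.trans h : a i = j)]; omega
  have hind_both : ∀ i j, f i = j → c i = j → (if a i = j then (1 : ℕ) else 0) + (if b i = j then 1 else 0) = 2 := by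
    intro i j hfj hcj
    rcases hfc i with ⟨h1, h2⟩ | ⟨h1, h2⟩
    · rw [if_pos (h1.symm.trans hfj), if_pos (h2.symm.trans hcj)]
    · rw [if_pos (h2.symm.trans hcj), if_pos (h1.symm.trans hfj)]
  -- three distinct rows, or one double row and another row, would exceed the column count 2
  have hle3 : ∀ (j : V) (s : Finset V),
      (∑ i ∈ s, ((if a i = j then (1 : ℕ) else 0) + (if b i = j then 1 else 0))) ≤ 2 := by
    intro j s
    calc (∑ i ∈ s, ((if a i = j then (1 : ℕ) else 0) + (if b i = j then 1 else 0)))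
        ≤ ∑ i, ((if a i = j then (1 : ℕ) else 0) + (if b i = j then 1 else 0)) :=
          Finset.sum_le_sum_of_subset_of_nonneg (Finset.subset_univ s) fun _ _ _ => Nat.zero_le _
      _ = 2 := by rw [Finset.sum_add_distrib]; exact hcol j
  have hcinj : Function.Injective c := by
    intro i i' hii'
    by_contra hne
    set j := c i with hj
    obtain ⟨i'', hi''⟩ := hfbij.2 j
    have hc1 := hind_c i j rfl
    have hc2 := hind_c i' j hii'.symm
    by_cases h1 : i'' = i
    · subst h1
      have h2 := hind_both _ j hi'' rfl
      have := hle3 j {i'', i'}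
      rw [Finset.sum_pair hne] at this
      omega
    by_cases h2 : i'' = i'
    · subst h2
      have h3 := hind_both _ j hi'' hii'.symm
      have := hle3 j {i, i''}
      rw [Finset.sum_pair hne] at this
      omega
    · have h3 := hind_f i'' j hi''
      have := hle3 j {i, i', i''}
      rw [Finset.sum_insert (by simp [hne, Ne.symm h1]), Finset.sum_pair (Ne.symm h2)] at this
      omega
  have hcbij : Function.Bijective c := Finite.injective_iff_bijective.mp hcinj
  refine ⟨Equiv.ofBijective f hfbij, Equiv.ofBijective c hcbij, fun i => ?_⟩
  change List.Perm [R i, f i, c i] [σ₁ i, σ₂ i, σ₃ i]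
  rcases hfc i with ⟨h1, h2⟩ | ⟨h1, h2⟩
  · rw [h1, h2]; exact hPab i
  · rw [h1, h2]; exact (List.Perm.cons (R i) (List.Perm.swap (a i) (b i) [])).trans (hPab i)

/-- **TRIPLE EXCHANGE LEMMA (no third cover).**  Let `σ₁, σ₂, σ₃` be the unique maximisers at `θ₁ < θ₂ < θ₃`, and assume the
SLOPE DOMINATION: in every factorisation `(F₁, F₂, F₃)` of `σ₁ ⊎ σ₂ ⊎ σ₃` some factor has slope `≤` that of `σ₁` and ANOTHER factor
has slope `≥` that of `σ₃` (listed as the six ordered choices).  Then every cover whose arcs are arcs of `σ₁, σ₂, σ₃` is one of them.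
[this seat's lemma; THEOREM-FOURBIT.md Lemmas 1–2 (triples)] -/
theorem no_third_cover (ok : V → V → Prop) (w g : V → V → ℤ) {θ₁ θ₂ θ₃ : ℤ} (h12 : θ₁ < θ₂) (h23 : θ₂ < θ₃)
    {σ₁ σ₂ σ₃ : Equiv.Perm V}
    (h₁ : (∀ i, ok i (σ₁ i)) ∧ ∀ τ : Equiv.Perm V, τ ≠ σ₁ → (∀ i, ok i (τ i)) →
      ∑ i, (w i (τ i) + θ₁ * g i (τ i)) < ∑ i, (w i (σ₁ i) + θ₁ * g i (σ₁ i)))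
    (h₂ : (∀ i, ok i (σ₂ i)) ∧ ∀ τ : Equiv.Perm V, τ ≠ σ₂ → (∀ i, ok i (τ i)) →
      ∑ i, (w i (τ i) + θ₂ * g i (τ i)) < ∑ i, (w i (σ₂ i) + θ₂ * g i (σ₂ i)))
    (h₃ : (∀ i, ok i (σ₃ i)) ∧ ∀ τ : Equiv.Perm V, τ ≠ σ₃ → (∀ i, ok i (τ i)) →
      ∑ i, (w i (τ i) + θ₃ * g i (τ i)) < ∑ i, (w i (σ₃ i) + θ₃ * g i (σ₃ i)))
    (hcomb : ∀ F₁ F₂ F₃ : Equiv.Perm V, (∀ i, List.Perm [F₁ i, F₂ i, F₃ i] [σ₁ i, σ₂ i, σ₃ i]) →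
      ((∑ i, g i (F₁ i)) ≤ (∑ i, g i (σ₁ i)) ∧ (∑ i, g i (σ₃ i)) ≤ ∑ i, g i (F₂ i)) ∨
      ((∑ i, g i (F₁ i)) ≤ (∑ i, g i (σ₁ i)) ∧ (∑ i, g i (σ₃ i)) ≤ ∑ i, g i (F₃ i)) ∨
      ((∑ i, g i (F₂ i)) ≤ (∑ i, g i (σ₁ i)) ∧ (∑ i, g i (σ₃ i)) ≤ ∑ i, g i (F₁ i)) ∨
      ((∑ i, g i (F₂ i)) ≤ (∑ i, g i (σ₁ i)) ∧ (∑ i, g i (σ₃ i)) ≤ ∑ i, g i (F₃ i)) ∨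
      ((∑ i, g i (F₃ i)) ≤ (∑ i, g i (σ₁ i)) ∧ (∑ i, g i (σ₃ i)) ≤ ∑ i, g i (F₁ i)) ∨
      ((∑ i, g i (F₃ i)) ≤ (∑ i, g i (σ₁ i)) ∧ (∑ i, g i (σ₃ i)) ≤ ∑ i, g i (F₂ i)))
    (R : Equiv.Perm V) (hR : ∀ i, R i = σ₁ i ∨ R i = σ₂ i ∨ R i = σ₃ i) : R = σ₁ ∨ R = σ₂ ∨ R = σ₃ := by
  obtain ⟨M₂, M₃, hP⟩ := two_factor σ₁ σ₂ σ₃ R hR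
  -- reorderings of the factorisation
  have s12 : ∀ {F₁ F₂ F₃ : Equiv.Perm V}, (∀ i, List.Perm [F₁ i, F₂ i, F₃ i] [σ₁ i, σ₂ i, σ₃ i]) →
      ∀ i, List.Perm [F₂ i, F₁ i, F₃ i] [σ₁ i, σ₂ i, σ₃ i] :=
    @fun F₁ F₂ F₃ h i => (List.Perm.swap (F₁ i) (F₂ i) [F₃ i]).trans (h i)
  have s23 : ∀ {F₁ F₂ F₃ : Equiv.Perm V}, (∀ i, List.Perm [F₁ i, F₂ i, F₃ i] [σ₁ i, σ₂ i, σ₃ i]) →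
      ∀ i, List.Perm [F₁ i, F₃ i, F₂ i] [σ₁ i, σ₂ i, σ₃ i] :=
    @fun F₁ F₂ F₃ h i => (List.Perm.cons (F₁ i) (List.Perm.swap (F₂ i) (F₃ i) [])).trans (h i)
  rcases hcomb R M₂ M₃ hP with ⟨hl, hh⟩ | ⟨hl, hh⟩ | ⟨hl, hh⟩ | ⟨hl, hh⟩ | ⟨hl, hh⟩ | ⟨hl, hh⟩
  · exact Or.inl (factors_eq ok w g h12 h23 h₁ h₂ h₃ (s23 hP) hl hh).1
  · exact Or.inl (factors_eq ok w g h12 h23 h₁ h₂ h₃ hP hl hh).1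
  · exact Or.inr (Or.inr (factors_eq ok w g h12 h23 h₁ h₂ h₃ (s23 (s12 hP)) hl hh).2.2)
  · exact Or.inr (Or.inl (factors_eq ok w g h12 h23 h₁ h₂ h₃ (s12 hP) hl hh).2.1)
  · exact Or.inr (Or.inr (factors_eq ok w g h12 h23 h₁ h₂ h₃ (s12 (s23 (s12 hP))) hl hh).2.2)
  · exact Or.inr (Or.inl (factors_eq ok w g h12 h23 h₁ h₂ h₃ (s12 (s23 hP)) hl hh).2.1)

end FourBit
end MarkedEdge
end Summit.ValiantsHypothesis.ValiantsHypothesis.Theorems.KPlusLogSqLaw
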